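import Summits.BirchSwinnertonDyer.Rank1Residual.X1.EisensteinSqueeze
import Summits.BirchSwinnertonDyer.Rank1Residual.X1.RankOneResidualDescent
import Summits.BirchSwinnertonDyer.Rank1Residual.X1.RankOneTamagawaSqueezeCited
import Summits.BirchSwinnertonDyer.Rank1Residual.X1.RankOnePAdicBSD
import HarnessLib

/-!
# Route E at RANK ONE on class X1 — the LEADING-TERM squeeze:
# `ord_p [T¹](ϖ·L_p(E,T)) = 1 ∧ λ_alg(E,p) ≥ 2 ⇒` Mazur's main conjecture `∧ BSD(E,p)`

HONEST FRAMING (cell `b2b-bsdres`, run/shared/lean/b2b/bsd-rank1-residual/, verbatim in every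
file): the goal of the cell is to DELETE the COMBINATION-SHAPED residual classes of the
Birch–Swinnerton-Dyer formula for ALL analytic-rank `≤ 1` elliptic curves over `ℚ` — "full BSD
formula for every rank `≤ 1` curve in class `C`" assembled STRICTLY from published theorems — so
that the rank-`≤ 1` remainder becomes exactly the CONSTRUCTION-SHAPED classes, which are TYPED
(missing-input `Prop`s), NOT attempted. This is not "finishing BSD". Unit `b2b-bsdres-x1a` (X1 prover
A; CLASS-OWNERS row "X1 (r = 1)"), gen 15: research route; NO CLAIM BEYOND STATED CLASSES; nothing
here changes a label; no new named fact. ONE typed def (`AnalyticCoeffOneVal W p v`: "`ord_p` of the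
LINEAR coefficient of `ϖ·L_p(E,T)` is `v`", one coefficient of the `p`-adic `L`-function, nothing
asserted — the rank-one twin of sub-cell eisenstein-p1's `AnalyticConstCoeffVal`); everything else is
a theorem over PUBLISHED named facts and the cell's typed per-pair inputs.

WHY THIS FILE. Sub-cell eisenstein-p1's route E (`X1/EisensteinSqueeze.lean`, `X1/ConstantTermSqueeze.lean`)
closes Mazur's main conjecture on the RANK-ZERO leaf from ONE coefficient: if `ord_p c₀(ϖ·L_p) = 1` then
in Kato–Wuthrich's factorisation `ϖ·L_p = ι(f_E·h)` one of `f_E(0)`, `h(0)` is a unit (Greenberg, LNM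
1716 p. 131). At RANK ONE `c₀ = 0` and the same arithmetic moves to the linear term: by Perrin-Riou–
Schneider (Balakrishnan–Müller–Stein Thm. 1.7 (1), tree fact `Schneider1985_order_charGenerator_odd`:
`ord_{T=0} f_E ≥ rank E(ℚ)`) `f_E(0) = 0` when `rank E(ℚ) ≥ 1`, so `c₁ = [T¹](f_E·h) = [T¹]f_E · h(0)`,
and `ord_p c₁ = 1` forces EITHER `h(0) ∈ ℤ_pˣ` — `h ∈ Λˣ`, `char X = (f_E·h)`: THE MAIN CONJECTURE — OR
`[T¹]f_E ∈ ℤ_pˣ`, i.e. `λ(X) = λ(f_E) = 1`. The second branch is killed by ANY certified lower bound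
`λ_alg ≥ 2` (route T `AlgebraicLambdaGE W p 2`; route D `ResidualDescentBound W p k e`, `e + 2 ≤ k`, at
`μ_an = 0`; Kundu–Ray 2024 Lemma 6.3 with ONE Tamagawa prime `p ∣ c_ℓ` at a member without rational
`p`-torsion — CITED). NO `λ_an`, NO parity, NO Newton polygon, NO `#Ш(E/ℚ)_an`. And `ord_p c₁ = 1 < ∞`
IS the Schneider certificate `[T¹]L_p ≠ 0` (x1a `RankOne.Leaf.schneider_of_coeff_one_ne_zero`), so on
the rank-one leaf the SAME datum turns the main conjecture into `BSD(E,p)`: ONE coefficient valuation +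
ONE structural lower bound ⇒ `MC ∧ BSD(E,p)`, per pair.

* §1 (Λ-algebra, PROVED): the leading-term dichotomy `lam_eq_one_or_isUnit_of_valuation_coeff_one_mul_eq_one`.
* §2 (TYPED) `AnalyticCoeffOneVal W p v`; reading lemma; `v ≠ 0 ⇒ [T¹]L_p(f,α) ≠ 0`.
* §3 (PROVED) `mazurMainConjecture_of_coeffOneVal_one_of_algebraicLambdaGE` (`p ≠ 2` good ordinary,
  `E[p]` reducible, `rank E(ℚ) ≥ 1`, `ord_p c₁ = 1`, `λ_alg ≥ 2` ⇒ MC).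
* §4 on the rank-one leaf `RankOne.Leaf` (either Greenberg–Vatsal type; rank `1` by GZK):
  `RankOne.Leaf.mazurMainConjecture_and_bsdp_of_coeffOneVal_one_of_algebraicLambdaGE` (**headline**),
  `…_of_pDvdTamagawaAt` (Kundu–Ray, cited, `#E(ℚ)[p^∞] = 1`); the route-D-fed and isogeny-transported
  bounds and route N's factor pattern at rank one are in the sibling `X1/RankOneFactorSqueeze.lean`.

Census (x1a gen 15, HOME/b2b-bsdres-x1a/gen15/ROUTE-EN-R1.md): of the 868 type-A rank-one X1 classes at
`p = 3`, `N < 5·10⁵`, with no per-pair route after gen 14, engine C (iw-1) finds `μ = 0`, `ord_3 c₁ = 1`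
at member 1 of 472; 470 of these carry `λ_alg ≥ 2` on file (route T / D). What this is NOT: a class
theorem; a change of the class-level residue (X1-CHAIN §17b). TIER, honestly: under `BSD(E,p)`,
`ord_p c₁ = 2·ord_p #Ẽ(𝔽_p) + ord_p Reg_γ + ord_p ∏c_ℓ + ord_p #Ш − 2·ord_p #E(ℚ)_tors` (BMS Thm. 1.7
(3)); the route does not USE `#Ш_an` or the regulator, but `ord_p c₁ = 1` constrains that sum.

References: [BalakrishnanMullerStein2015] Thm. 1.7; [GreenbergLNM1716] §5 p. 131, Prop. 3.10;
[Wuthrich2014] Thm. 16; [PerrinRiou1987] §1.4; [KunduRay2024] Lemma 6.3; [Washington1997] §7.1;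
HOME/b2b-bsdres-eisenstein-p1/X1R0-GAPMAP.md §19–§20; HOME/b2b-bsdres-x1a/X1-CHAIN.md §24.
-/

noncomputable section

open scoped Classical MatrixGroups ModularForm

open PowerSeries CongruenceSubgroup WeierstrassCurve Literature.NumberTheory.EllipticCurves
  Literature.NumberTheory.EllipticCurves.ModularForms
  Literature.NumberTheory.EllipticCurves.Wuthrich2014
  Literature.NumberTheory.EllipticCurves.Rank1Residual
  Literature.NumberTheory.EllipticCurves.Greenberg1999
  Literature.NumberTheory.EllipticCurves.KunduRay2024
  Summit.BirchSwinnertonDyer.BirchSwinnertonDyer.Theorems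
  Summit.BirchSwinnertonDyer.BirchSwinnertonDyer.Theorems.Rank1ResidualX1Defs
  Summit.BirchSwinnertonDyer.Rank1Residual.X1.MuLambda
  Summit.BirchSwinnertonDyer.Rank1Residual.X1.MuPart
  Summit.BirchSwinnertonDyer.Rank1Residual.X1.ParitySqueeze
  Summit.BirchSwinnertonDyer.Rank1Residual.X1.TamagawaSqueeze
  Summit.BirchSwinnertonDyer.Rank1Residual.X1.ResidualDescent
  Summit.BirchSwinnertonDyer.Rank1Residual.X1.EisensteinSqueeze

set_option autoImplicit false

namespace Summit.BirchSwinnertonDyer.Rank1Residual.X1.RankOneLeadingTermSqueeze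

/-! ## §1. `Λ`-algebra: the linear coefficient of `g·h` when `g(0) = 0` -/

section Algebra

variable {p : ℕ} [Fact p.Prime]

/-- **`[T¹](g·h) = [T¹]g · h(0)` when `g(0) = 0`** (Cauchy product in `Λ = ℤ_p⟦T⟧`). [folklore] -/
theorem coeff_one_mul_of_constantCoeff_eq_zero {g h : IwasawaAlgebra p} (hg0 : constantCoeff g = 0) :
    coeff 1 (g * h) = coeff 1 g * constantCoeff h := by
  rw [coeff_mul, Finset.Nat.sum_antidiagonal_succ, Finset.Nat.antidiagonal_zero, Finset.sum_singleton,
    coeff_zero_eq_constantCoeff_apply, hg0, zero_mul, zero_add, zero_add,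
    coeff_zero_eq_constantCoeff_apply]

/-- **`g(0) = 0` and `[T¹]g ∈ ℤ_pˣ` ⇒ `λ(g) = 1`** (and `μ(g) = 0`): `g ≢ 0 (mod p)`, so `g` is its own
`p`-free part, and `g mod p = ū·T + …` has order exactly `1` (Washington §7.1). [cite: Washington1997, §7.1] -/
theorem lam_eq_one_of_constantCoeff_eq_zero_of_isUnit_coeff_one {g : IwasawaAlgebra p}
    (hg0 : constantCoeff g = 0) (hu : IsUnit (coeff 1 g)) : lam g = 1 := by
  have hc1 : coeff 1 (red g) ≠ 0 := by
    rw [coeff_map, Ne, IsLocalRing.residue_eq_zero_iff]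
    exact fun hm ↦ (IsLocalRing.mem_maximalIdeal _).mp hm hu
  have hred : red g ≠ 0 := fun h0 ↦ hc1 (by rw [h0, map_zero])
  have hfac : g = C ((p : ℤ_[p]) ^ 0) * g := by rw [pow_zero, map_one, one_mul]
  obtain ⟨-, hpf⟩ := mu_eq_and_pfree_eq hred hfac
  have hord : (red g).order = 1 := by
    rw [show (1 : ℕ∞) = ((1 : ℕ) : ℕ∞) from rfl, order_eq_nat]
    refine ⟨hc1, fun i hi ↦ ?_⟩
    obtain rfl : i = 0 := by omega
    rw [coeff_map, coeff_zero_eq_constantCoeff_apply, hg0, map_zero]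
  rw [lam, hpf, hord]
  rfl

/-- **The leading-term dichotomy in `Λ`.** If `g(0) = 0` and the LINEAR coefficient of `g·h` has
`p`-adic valuation `1`, then `1 = ord_p [T¹]g + ord_p h(0)` with both summands `≥ 0`, so either
`h(0) ∈ ℤ_pˣ` — `h` is a UNIT of `Λ` — or `[T¹]g ∈ ℤ_pˣ` and `λ(g) = 1`. The rank-one twin of
eisenstein-p1's `EisensteinSqueeze.lam_eq_zero_or_of_valuation_constantCoeff_mul_eq_one` (Greenberg, LNM
1716 p. 131, on the constant term). [cite: GreenbergLNM1716, §5 p. 131] [cite: Washington1997, §7.1] -/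
theorem lam_eq_one_or_isUnit_of_valuation_coeff_one_mul_eq_one {g h : IwasawaAlgebra p}
    (hg0 : constantCoeff g = 0) (hv : ((coeff 1 (g * h) : ℤ_[p]) : ℚ_[p]).valuation = 1) :
    lam g = 1 ∨ IsUnit h := by
  have hne : coeff 1 (g * h) ≠ 0 := by
    intro h0
    rw [h0, PadicInt.coe_zero, Padic.valuation_zero] at hv
    exact zero_ne_one hv
  rw [coeff_one_mul_of_constantCoeff_eq_zero hg0] at hne hv
  have hg1 : coeff 1 g ≠ 0 := fun h0 ↦ hne (by rw [h0, zero_mul])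
  have hh0 : constantCoeff h ≠ 0 := fun h0 ↦ hne (by rw [h0, mul_zero])
  rw [PadicInt.coe_mul, Padic.valuation_mul (PadicInt.coe_ne_zero.mpr hg1)
    (PadicInt.coe_ne_zero.mpr hh0)] at hv
  have hvg := PadicInt.valuation_coe_nonneg (x := coeff 1 g)
  have hvh := PadicInt.valuation_coe_nonneg (x := constantCoeff h)
  rcases Int.le_iff_eq_or_lt.mp hvh with hh' | hh'
  · exact Or.inr (isUnit_of_valuation_constantCoeff_eq_zero hh0 hh'.symm)
  · left
    refine lam_eq_one_of_constantCoeff_eq_zero_of_isUnit_coeff_one hg0 ?_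
    have hv0 : ((coeff 1 g : ℤ_[p]) : ℚ_[p]).valuation = 0 := by omega
    rw [PadicInt.isUnit_iff, PadicInt.norm_eq_zpow_neg_valuation hg1]
    have e := PadicInt.valuation_coe (coeff 1 g : ℤ_[p])
    rw [hv0] at e
    have e' : (coeff 1 g : ℤ_[p]).valuation = 0 := by exact_mod_cast e.symm
    rw [e']
    simp

end Algebra

/-! ## §2. "`ord_p` of the linear coefficient of `ϖ·L_p(E,T)` is `v`", TYPED (nothing asserted) -/

/-- **"`ord_p [T¹](ϖ·L_p(E,T)) = v`" (TYPED; nothing asserted).** For the newform `f` of `E` at level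
`N_E` and every rational `ϖ` with `ϖ·Ω_E = Ω⁺_f` (the Néron normalisation of `X1/MuLambda.lean`): the
LINEAR coefficient `c₁ = ϖ · [T¹]L_p(f,α)(T)` (`α` the unit root, `T = γ − 1` the tree's cyclotomic
variable) has `p`-adic valuation `v`. A FINITE per-pair datum of the same kind as `AnalyticMuLE` /
`AnalyticLambdaEq` / eisenstein-p1's `AnalyticConstCoeffVal` (ONE coefficient of the `p`-adic
`L`-function; certified per pair by a modular-symbol engine — iw-1's engine C (twisted `L`-values +
Birch's formula, x1a gen-10 column `C_v_c1`) and eisenstein-p1's ENGINE-B Riemann sums as second engine).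
For `v ≠ 0` it entails `[T¹]L_p(f,α) ≠ 0` (`AnalyticCoeffOneVal.coeff_one_ne_zero`), the Schneider
certificate of `X1/RankOne.lean`. TIER, honestly: at a rank-one pair, granted `BSD(E,p)`, `v` is the
integer `2·ord_p #Ẽ(𝔽_p) + ord_p Reg_γ + ord_p ∏c_ℓ + ord_p #Ш(E/ℚ) − 2·ord_p #E(ℚ)_tors`
(Balakrishnan–Müller–Stein Thm. 1.7 (3)) — the route below does not use `#Ш_an` or the regulator.
[cite: MazurTateTeitelbaum1986Invent, §I.13–I.14 (shape only; nothing asserted)] -/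
def AnalyticCoeffOneVal (W : WeierstrassCurve ℚ) [W.IsElliptic] [W.IsGloballyMinimal] (p : ℕ)
    [Fact p.Prime] (v : ℤ) : Prop :=
  ∀ [NeZero (W.conductorNorm ℤ)] (f : CuspForm (Gamma0 (W.conductorNorm ℤ)) 2),
    IsNewformOf W f → ∀ (ϖ : ℚ), (ϖ : ℝ) * W.realPeriodRat = plusPeriod f →
      ((ϖ : ℚ_[p]) * PowerSeries.coeff 1
        (padicLFunction f (unitRoot W p : ℚ_[p]))).valuation = v

section Basic

variable {W : WeierstrassCurve ℚ} [W.IsElliptic] [W.IsGloballyMinimal] {p : ℕ} [Fact p.Prime]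

/-- Reading the typed linear-coefficient valuation on a `Λ`-factorisation `ι(g) = ϖ·L_p`: the linear
coefficient of `g ∈ Λ` has valuation `v` (`ι` is coefficientwise `ℤ_p ↪ ℚ_p`). [folklore] -/
theorem AnalyticCoeffOneVal.valuation_coeff_one_eq {v : ℤ} (hc : AnalyticCoeffOneVal W p v)
    [NeZero (W.conductorNorm ℤ)] {f : CuspForm (Gamma0 (W.conductorNorm ℤ)) 2} (hf : IsNewformOf W f)
    {ϖ : ℚ} (hϖ : (ϖ : ℝ) * W.realPeriodRat = plusPeriod f) {g : IwasawaAlgebra p}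
    (hι : iwasawaToPowerSeries p g = C (ϖ : ℚ_[p]) * padicLFunction f (unitRoot W p : ℚ_[p])) :
    ((coeff 1 g : ℤ_[p]) : ℚ_[p]).valuation = v := by
  have e : coeff 1 (iwasawaToPowerSeries p g) = ((coeff 1 g : ℤ_[p]) : ℚ_[p]) := by
    rw [iwasawaToPowerSeries, coeff_map]; rfl
  rw [← e, hι, coeff_C_mul]
  exact hc f hf ϖ hϖ

/-- **`ord_p c₁ = v ≠ 0` entails the Schneider certificate `[T¹]L_p(f,α) ≠ 0`** for the newform of
`E` (Mathlib's convention `valuation 0 = 0` is why `v ≠ 0` is needed). [folklore] -/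
theorem AnalyticCoeffOneVal.coeff_one_ne_zero {v : ℤ} (hc : AnalyticCoeffOneVal W p v) (hv : v ≠ 0)
    [NeZero (W.conductorNorm ℤ)] {f : CuspForm (Gamma0 (W.conductorNorm ℤ)) 2} (hf : IsNewformOf W f)
    {ϖ : ℚ} (hϖ : (ϖ : ℝ) * W.realPeriodRat = plusPeriod f) :
    coeff 1 (padicLFunction f (unitRoot W p : ℚ_[p])) ≠ 0 := by
  intro h0
  have e := hc f hf ϖ hϖ
  rw [h0, mul_zero, Padic.valuation_zero] at e
  exact hv e.symm

end Basic

/-! ## §3. The leading-term squeeze: `ord_p c₁ = 1 ∧ rank E(ℚ) ≥ 1 ∧ λ_alg ≥ 2 ⇒` Mazur's MC -/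

section Squeeze

variable {W : WeierstrassCurve ℚ} [W.IsElliptic] [W.IsGloballyMinimal] {p : ℕ} [Fact p.Prime]

/-- **The characteristic power series vanishes at `T = 0` when `rank E(ℚ) ≥ 1`** (`f_E(0) = 0`): clause
(1) `ord_{T=0} f_E ≥ rank E(ℚ)` of Perrin-Riou–Schneider (Balakrishnan–Müller–Stein Thm. 1.7, `hS`,
PUBLISHED), the canonical height datum existing at an odd good ordinary prime (Mazur–Tate `σ`, `hMT`).
[cite: BalakrishnanMullerStein2015, Thm. 1.7 (1)] [cite: Balakrishnan2016, §2 eq. (2.3)] -/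
theorem constantCoeff_charGenerator_eq_zero (hS : Schneider1985_order_charGenerator_odd)
    (hMT : mazur_tate_sigma_exists_odd) (hp : p ≠ 2) (hgood : W.HasGoodReductionAtPrime p)
    (hord : ¬ (p : ℤ) ∣ W.frobeniusTrace p) (hrk : 1 ≤ W.mordellWeilRank)
    {κ : ZpExtension ℚ p} {γ : Field.absoluteGaloisGroup ℚ}
    (hκ : κ.IsCyclotomic) (hγ : κ.IsTopGenerator γ) (hγ' : IsCyclotomicVariable p γ)
    (D : W.SelmerDualData κ γ) [Module.Finite (IwasawaAlgebra p) D.X] (hX : D.IsTorsion)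
    {fE : IwasawaAlgebra p} (hchar : D.charIdeal = Ideal.span {fE}) : constantCoeff fE = 0 := by
  obtain ⟨Dh, -, hle, -⟩ := hS.exists_canonical hMT W p hp hgood hord hκ hγ hγ' D hX hchar
  have h1 : ((1 : ℕ) : ℕ∞) ≤ fE.order := le_trans (by exact_mod_cast hrk) hle
  have h0 : ((0 : ℕ) : ℕ∞) < fE.order := lt_of_lt_of_le (by exact_mod_cast Nat.zero_lt_one) h1
  rw [← coeff_zero_eq_constantCoeff_apply]
  exact coeff_of_lt_order 0 h0

/-- **ROUTE E AT RANK ONE — the leading-term squeeze, at one cyclotomic datum.** `W/ℚ` globally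
minimal elliptic, `p ≠ 2` good ordinary with `E[p]` reducible and `rank E(ℚ) ≥ 1`. Granted the PUBLISHED
facts Wuthrich 2014 Thm. 16 (`hW16`: `X` torsion, `ϖ·L_p = ι(f_E·h)` with `h ∈ Λ`), Balakrishnan–Müller–Stein
Thm. 1.7 (1) (`hS`: `f_E(0) = 0` at positive rank) and Mazur–Tate (`hMT`, existence of the canonical height
datum): if `ord_p [T¹](ϖ·L_p) = 1` (`AnalyticCoeffOneVal W p 1`) and `λ(X) ≥ 2` for THIS dual datum `D`
(hypothesis `h2`), then `char X = (g)` with `ι g = ϖ·L_p(f,α)`: `[T¹](f_E·h) = [T¹]f_E · h(0)` has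
valuation `1`, so either `h(0) ∈ ℤ_pˣ` (`h ∈ Λˣ`, `char X = (f_E·h)`) or `λ(f_E) = 1 < 2 ≤ λ(X) = λ(f_E)` —
absurd. No `λ_an`, `μ_an`, parity, Newton polygon or `#Ш(E/ℚ)_an` is used.
[cite: BalakrishnanMullerStein2015, Thm. 1.7 (1)] [cite: Wuthrich2014, Thm. 16 (p. 397)]
[cite: GreenbergLNM1716, §5 p. 131] [cite: Washington1997, §7.1] -/
theorem isTorsion_and_exists_charIdeal_eq_of_coeffOneVal_one
    (hW16 : Wuthrich2014.charIdeal_dvd_padicLFunction) (hS : Schneider1985_order_charGenerator_odd)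
    (hMT : mazur_tate_sigma_exists_odd) (hp : p ≠ 2) (hgood : W.HasGoodReductionAtPrime p)
    (hord : ¬ (p : ℤ) ∣ W.frobeniusTrace p) (hred : ¬ W.HasIrreducibleModPGaloisRep p)
    (hrk : 1 ≤ W.mordellWeilRank) (hc : AnalyticCoeffOneVal W p 1)
    {κ : ZpExtension ℚ p} {γ : Field.absoluteGaloisGroup ℚ}
    (hκ : κ.IsCyclotomic) (hγ : κ.IsTopGenerator γ) (hγ' : IsCyclotomicVariable p γ)
    [NeZero (W.conductorNorm ℤ)] {f : CuspForm (Gamma0 (W.conductorNorm ℤ)) 2} (hf : IsNewformOf W f)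
    {ϖ : ℚ} (hϖ : (ϖ : ℝ) * W.realPeriodRat = plusPeriod f) (D : W.SelmerDualData κ γ)
    [Module.Finite (IwasawaAlgebra p) D.X] (h2 : D.IsTorsion → 2 ≤ lambdaInvariant p D.X) :
    D.IsTorsion ∧ ∃ g : IwasawaAlgebra p, D.charIdeal = Ideal.span {g} ∧
      iwasawaToPowerSeries p g = C (ϖ : ℚ_[p]) * padicLFunction f (unitRoot W p : ℚ_[p]) := by
  -- Wuthrich Thm. 16: `X` torsion, `ι g = ϖ · L_p(f, α)` with `g ∈ char X = (fE)`, `g = fE · h`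
  obtain ⟨hX, g, hgmem, hιg⟩ := hW16 W p hp ⟨hgood, hord⟩ hred hκ hγ hγ' hf D ϖ hϖ
  obtain ⟨fE, hchar⟩ := (charIdeal_isPrincipal_holds p D.X).principal
  have hchar' : D.charIdeal = Ideal.span {fE} := hchar
  have hgmem' : g ∈ Ideal.span {fE} := by rw [← hchar']; exact hgmem
  obtain ⟨h, hgh⟩ := Ideal.mem_span_singleton'.mp hgmem'
  have hfac : fE * h = g := by rw [mul_comm]; exact hgh
  have hιg' : iwasawaToPowerSeries p (fE * h) =
      C (ϖ : ℚ_[p]) * padicLFunction f (unitRoot W p : ℚ_[p]) := by rw [hfac, hιg]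
  have hg0 : fE * h ≠ 0 := mul_ne_zero_of_iota_eq hgood hord hf hϖ D hιg'
  have hfE0 : fE ≠ 0 := fun e ↦ hg0 (by rw [e, zero_mul])
  -- `fE(0) = 0` (rank ≥ 1) and `ord_p [T¹](fE·h) = 1`
  have hfE00 : constantCoeff fE = 0 :=
    constantCoeff_charGenerator_eq_zero hS hMT hp hgood hord hrk hκ hγ hγ' D hX hchar'
  have hval : ((coeff 1 (fE * h) : ℤ_[p]) : ℚ_[p]).valuation = 1 := hc.valuation_coeff_one_eq hf hϖ hιg'
  rcases lam_eq_one_or_isUnit_of_valuation_coeff_one_mul_eq_one hfE00 hval with h1 | hunit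
  · -- `λ(fE) = 1` contradicts `λ(X) ≥ 2`
    have h2' : 2 ≤ lambdaInvariant p D.X := h2 hX
    rw [← lam_generator_eq_lambdaInvariant D.X hX hfE0 hchar', h1] at h2'
    exact absurd h2' (by omega)
  · refine ⟨hX, g, ?_, hιg⟩
    rw [hchar', ← hfac]
    exact ((span_eq_span_iff_isUnit hfE0 rfl).mpr hunit).symm

/-- **ROUTE E AT RANK ONE: `ord_p c₁ = 1 ∧ rank E(ℚ) ≥ 1 ∧ λ_alg ≥ 2 ⇒` MAZUR'S MAIN CONJECTURE** at a
good ordinary Eisenstein pair, `p ≠ 2` — the lower bound as route T's typed input `AlgebraicLambdaGE W p 2`.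
Facts: Wuthrich Thm. 16, BMS Thm. 1.7 (1), Mazur–Tate `σ`; all PUBLISHED. No `λ_an`, `μ_an`, parity or
`#Ш(E/ℚ)_an`. [cite: BalakrishnanMullerStein2015, Thm. 1.7 (1)] [cite: Wuthrich2014, Thm. 16 (p. 397)]
[cite: GreenbergLNM1716, §5 p. 131] -/
theorem mazurMainConjecture_of_coeffOneVal_one_of_algebraicLambdaGE
    (hW16 : Wuthrich2014.charIdeal_dvd_padicLFunction) (hS : Schneider1985_order_charGenerator_odd)
    (hMT : mazur_tate_sigma_exists_odd) (hp : p ≠ 2) (hgood : W.HasGoodReductionAtPrime p)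
    (hord : ¬ (p : ℤ) ∣ W.frobeniusTrace p) (hred : ¬ W.HasIrreducibleModPGaloisRep p)
    (hrk : 1 ≤ W.mordellWeilRank) (hc : AnalyticCoeffOneVal W p 1) (hk : AlgebraicLambdaGE W p 2) :
    MazurMainConjecture W p := by
  intro κ γ hκ hγ hγ' _ f hf ϖ hϖ D
  haveI : Module.Finite (IwasawaAlgebra p) D.X := D.module_finite_holds hγ
  exact isTorsion_and_exists_charIdeal_eq_of_coeffOneVal_one hW16 hS hMT hp hgood hord hred hrk hc hκ hγ
    hγ' hf hϖ D (fun hX ↦ hk κ γ hκ hγ D hX)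

end Squeeze

/-! ## §4. On the rank-one leaf X1 ∩ {r = 1}: `ord_p c₁ = 1 ∧ λ_alg ≥ 2 ⇒` Mazur's MC `∧ BSD(E,p)` -/

section Leaf

variable {W : WeierstrassCurve ℚ} [W.IsElliptic] [W.IsGloballyMinimal] {p : ℕ} [Fact p.Prime]

/-- **`ord_p c₁ = v ≠ 0` on the rank-one leaf IS the Schneider certificate**: THE canonical cyclotomic
`p`-adic height at `(E,p)` is non-degenerate (x1a's converter `RankOne.Leaf.schneider_of_coeff_one_ne_zero`:
Perrin-Riou 1987 `hPR` + GZK, applied to the level-`N_E` newform given by modularity `hmod`).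
[cite: PerrinRiou1987, §1.4 Cor. 1.8] [cite: SteinWuthrich2013, §§3–4, §9] -/
theorem _root_.Summit.BirchSwinnertonDyer.Rank1Residual.X1.RankOne.Leaf.schneider_of_coeffOneVal
    (hPR : perrinRiou_rankOne_leadingTerms_odd) (hGZK : rank_eq_analyticRank_of_analyticRank_le_one)
    (hmod : nonempty_modularParametrizationData) (hL : RankOne.Leaf W p) {v : ℤ}
    (hc : AnalyticCoeffOneVal W p v) (hv : v ≠ 0) :
    ∀ Dh : PAdicHeightData W p, Dh.IsCanonical → SchneiderConjecture Dh := by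
  haveI : NeZero (W.conductorNorm ℤ) := ⟨(W.conductorNorm_pos_holds).ne'⟩
  obtain ⟨Dm⟩ := hmod W
  obtain ⟨ϖ, -, hϖeq, -⟩ := Dm.exists_rat_mul_realPeriodRat_eq_plusPeriod
  exact hL.schneider_of_coeff_one_ne_zero hPR hGZK Dm.f Dm.isNewformOf
    (hc.coeff_one_ne_zero hv Dm.isNewformOf hϖeq)

/-- **Route E on the rank-one leaf — Mazur's main conjecture** from `ord_p c₁ = 1` and route T's
`λ_alg ≥ 2` (`AlgebraicLambdaGE W p 2`); rank `1` by Gross–Zagier–Kolyvagin; either Greenberg–Vatsal type.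
[cite: BalakrishnanMullerStein2015, Thm. 1.7 (1)] [cite: Wuthrich2014, Thm. 16 (p. 397)]
[cite: GreenbergLNM1716, §5 p. 131 and Cor. 5.6 (proof, p. 136)] -/
theorem _root_.Summit.BirchSwinnertonDyer.Rank1Residual.X1.RankOne.Leaf.mazurMainConjecture_of_coeffOneVal_one_of_algebraicLambdaGE
    (hW16 : Wuthrich2014.charIdeal_dvd_padicLFunction) (hS : Schneider1985_order_charGenerator_odd)
    (hMT : mazur_tate_sigma_exists_odd) (hGZK : rank_eq_analyticRank_of_analyticRank_le_one)
    (hL : RankOne.Leaf W p) (hc : AnalyticCoeffOneVal W p 1) (hk : AlgebraicLambdaGE W p 2) :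
    MazurMainConjecture W p :=
  have hX := isClassX1_of_classX1 hL.1
  RankOneLeadingTermSqueeze.mazurMainConjecture_of_coeffOneVal_one_of_algebraicLambdaGE hW16 hS hMT hX.two_ne
    hX.hasGoodReductionAtPrime hX.not_dvd_frobeniusTrace hX.not_hasIrreducibleModPGaloisRep
    (by rw [hL.mordellWeilRank_eq_one hGZK]) hc hk

/-- **ROUTE E ON THE RANK-ONE LEAF — HEADLINE: `ord_p [T¹](ϖ·L_p(E,T)) = 1 ∧ λ_alg(E,p) ≥ 2 ⇒`
Mazur's main conjecture `∧ BSD(E,p)`.** ONE coefficient valuation (typed `AnalyticCoeffOneVal W p 1`,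
certified per pair by two modular-symbol engines) and ONE structural lower bound (route T's typed
`AlgebraicLambdaGE W p 2`); the same coefficient is the Schneider certificate, so `BSD(E,p)` follows by
x1a's `RankOne.Leaf.bsdp_of_mazurMainConjecture_of_schneider` (Perrin-Riou–Schneider, Perrin-Riou 1987,
Mazur–Tate `σ`, modularity, GZK — all PUBLISHED). No `λ_an`, no `μ_an`, no parity, no `#Ш(E/ℚ)_an`.
Census (x1a gen 15): 470 of the 868 type-A rank-one X1 classes at `p = 3`, `N < 5·10⁵` left without a
per-pair route by gen 14 (e.g. `1012b1 @ 3`, `1210e1 @ 3`).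
[cite: BalakrishnanMullerStein2015, Thm. 1.7] [cite: Wuthrich2014, Thm. 16 (p. 397)]
[cite: GreenbergLNM1716, §5 p. 131] [cite: PerrinRiou1987, §1.4 Cor. 1.8] -/
theorem _root_.Summit.BirchSwinnertonDyer.Rank1Residual.X1.RankOne.Leaf.mazurMainConjecture_and_bsdp_of_coeffOneVal_one_of_algebraicLambdaGE
    (hW16 : Wuthrich2014.charIdeal_dvd_padicLFunction) (hS : Schneider1985_order_charGenerator_odd)
    (hPR : perrinRiou_rankOne_leadingTerms_odd) (hMT : mazur_tate_sigma_exists_odd)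
    (hmod : nonempty_modularParametrizationData) (hGZK : rank_eq_analyticRank_of_analyticRank_le_one)
    (hL : RankOne.Leaf W p) (hc : AnalyticCoeffOneVal W p 1) (hk : AlgebraicLambdaGE W p 2) :
    MazurMainConjecture W p ∧ BSDp W p :=
  have hMC : MazurMainConjecture W p :=
    hL.mazurMainConjecture_of_coeffOneVal_one_of_algebraicLambdaGE hW16 hS hMT hGZK hc hk
  ⟨hMC, hL.bsdp_of_mazurMainConjecture_of_schneider hS hPR hMT hmod hGZK
    (hL.schneider_of_coeffOneVal hPR hGZK hmod hc one_ne_zero) hMC⟩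

/-- **Route E with the CITED lower bound (Kundu–Ray 2024 Lemma 6.3) on the rank-one leaf:
`ord_p c₁ = 1 ∧ μ_an(E) = 0 ∧ #E(ℚ)[p^∞] = 1 ∧ p ∣ c_ℓ(E)` for ONE prime `ℓ ≠ p` ⇒ Mazur's MC
`∧ BSD(E,p)`** — `λ(X) ≥ #{ℓ} + 1 = 2` by Kundu–Ray (`λ + μ ≥ #S + [anomalous]`, printed WITHOUT a rank
hypothesis; the leaf pair is anomalous, `RankOneTamagawaSqueezeCited.Leaf.dvd_reductionPointCount`; `Ш(E/ℚ)`
finite by GZK). Every input here is a PUBLISHED theorem or one of the two finite per-pair data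
`ord_p c₁ = 1`, `μ_an = 0`. [cite: KunduRay2024, Lemma 6.3] [cite: BalakrishnanMullerStein2015, Thm. 1.7]
[cite: Wuthrich2014, Thm. 16 (p. 397)] [cite: PerrinRiou1987, §1.4 Cor. 1.8] -/
theorem _root_.Summit.BirchSwinnertonDyer.Rank1Residual.X1.RankOne.Leaf.mazurMainConjecture_and_bsdp_of_coeffOneVal_one_of_pDvdTamagawaAt
    (hKR : lem63_card_add_anomalous_le_lambda_add_mu)
    (hW16 : Wuthrich2014.charIdeal_dvd_padicLFunction) (hS : Schneider1985_order_charGenerator_odd)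
    (hPR : perrinRiou_rankOne_leadingTerms_odd) (hMT : mazur_tate_sigma_exists_odd)
    (hmod : nonempty_modularParametrizationData) (hGZK : rank_eq_analyticRank_of_analyticRank_le_one)
    (hL : RankOne.Leaf W p) (hc : AnalyticCoeffOneVal W p 1) (hμ0 : AnalyticMuLE W p 0)
    (htors : Nat.card (AddCommGroup.primaryComponent W.toAffine.Point p) = 1)
    {ℓ : ℕ} (hℓp : ℓ ≠ p) (hℓ : PDvdTamagawaAt W p ℓ) : MazurMainConjecture W p ∧ BSDp W p := by
  have hX := isClassX1_of_classX1 hL.1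
  have hMC : MazurMainConjecture W p := by
    intro κ γ hκ hγ hγ' _ f hf ϖ hϖ D
    haveI : Module.Finite (IwasawaAlgebra p) D.X := D.module_finite_holds hγ
    refine isTorsion_and_exists_charIdeal_eq_of_coeffOneVal_one hW16 hS hMT hX.two_ne
      hX.hasGoodReductionAtPrime hX.not_dvd_frobeniusTrace hX.not_hasIrreducibleModPGaloisRep
      (by rw [hL.mordellWeilRank_eq_one hGZK]) hc hκ hγ hγ' hf hϖ D (fun _ ↦ ?_)
    obtain ⟨-, h2⟩ := TamagawaSqueezeCited.card_succ_le_lambdaInvariant hKR hW16 hmod hX.two_ne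
      hX.hasGoodReductionAtPrime hX.not_dvd_frobeniusTrace hX.not_hasIrreducibleModPGaloisRep
      (RankOneTamagawaSqueezeCited.Leaf.dvd_reductionPointCount hL) htors
      (hGZK W hL.analyticRank_eq_one.le).2 hμ0 (S := {ℓ})
      (fun q hq ↦ by rw [Finset.mem_singleton] at hq; subst hq; exact ⟨hℓp, hℓ⟩) hκ hγ hγ' D
    simpa using h2
  exact ⟨hMC, hL.bsdp_of_mazurMainConjecture_of_schneider hS hPR hMT hmod hGZK
    (hL.schneider_of_coeffOneVal hPR hGZK hmod hc one_ne_zero) hMC⟩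

end Leaf

end Summit.BirchSwinnertonDyer.Rank1Residual.X1.RankOneLeadingTermSqueeze

end
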